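import Summits.ValiantsHypothesis.ValiantsHypothesis.Theorems.BarrierLeverPartitionMinorsYOnlyFactor

/-!
# Route BarrierLever — Chow witnesses for partition minors (items 20172 / 20195): the
# COMPLEMENTARY-PRODUCTS door (x-private designs) and its cube-evaluation form

Helper file (`--supports stmt-ValiantsHypothesis-20195`; cell valiant-natproofs, rung V4, 𝒟-side of
door (c); seat val-np-p2 gen 7).  Closes NO item; definition-free.  Conventions of items 19717 /
20172 / 20195: `x_a = X (castAdd h a)`, `y_c = X (natAdd h c)`,
`E u w = Σ_{a∈u} e_{x_a} + Σ_{c∈w} e_{y_c}`; a layout `(u, w)` (`u w : Fin r → Finset (Fin h)`) is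
CHOW-HIT when some product of `h + h` affine forms `ℓ_q` has `det[coeff_{E (u i) (w j)} ∏ ℓ] ≠ 0`.

**x-PRIVATE designs.**  Take `h` forms `x_k + A_k(y)` (the variable `x_k` occurs in form `k` only;
`A_k` is any `y`-only polynomial, affine in the application) and `h` further `y`-only forms `B_j`.
Then for EVERY row set `U` and column set `W` (`coeff_partitionExpo_xPrivate`)

  `coeff_{E U W} ((∏_j B_j) · ∏_k (x_k + A_k)) = coeff_{E ∅ W} ((∏_j B_j) · ∏_{k ∉ U} A_k)`,

the `W`-coefficient of the COMPLEMENTARY PRODUCT `∏_{k ∉ U} A_k` (times `∏ B`): the partition matrix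
of an x-private product is a matrix of `y`-coefficients of near-complete sub-products of the `A_k`.
Hence the DOOR `chow_hit_of_complementaryProducts`: if for some affine `y`-forms `A_k, B_j` the
`y`-only determinant `det[coeff_{E ∅ (w j)} ((∏ B) · ∏_{k ∉ u i} A_k)]` is nonzero, the layout is
Chow-hit (by the `h + h` forms `x_k + A_k`, `B_j`).  With `B_j = 1 + y_j` the entries become CUBE
EVALUATIONS (`coeff_partitionExpo_cubeFactor_mul`):
`coeff_{E ∅ W} ((∏_c (1 + y_c)) · P) = Σ_{Z ⊆ W} coeff_{E ∅ Z} P` — the value at the `0/1` point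
`1_W` of the multilinear truncation of `P` — giving the door `chow_hit_of_cubeEvaluations`:
`det[ Σ_{Z ⊆ w j} coeff_{E ∅ Z} (∏_{k ∉ u i} A_k) ] ≠ 0 ⇒ (u, w)` is Chow-hit.

Why it matters (seat census, exact arithmetic, scripts `num/claimY*.py`, `num/residual*.py`): for
THIN rows (`|u i| ≤ 2`, item 20195) and generic affine `A_k` (already for `A_k = 1 + y_k + u_k Σ_c y_c`
with distinct `u_k`) the cube-evaluation matrix on ALL `1 + h + C(h,2)` thin rows has every maximal
minor nonzero at `h = 4` (4 368 / 4 368) and `h = 5` (0 dead among 2·10⁵ sampled), and all minors of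
size `≥ 8` at `h = 4` — the DENSE regime of item 20195, where the split/peel engine
(`chow_peel`, `chow_pairSplit[_mixed]`, `chow_hit_swap`) has no move; at `h = 4` the engine with the
tree's leaves plus this design leaves 23 of the 13 037 894 thin layouts.  The matrix
`W ↦ Σ_{Z ⊆ W} coeff_Z ∏_{k ∈ T} A_k` is the weighted MATCHING polynomial of the complete bipartite
graph `T × W` (weights = the coefficients of the `A_k`), i.e. the door turns the dense regime of the
item into a statement about minors of `ζᵀ · (⊕_j PermCompound_j(a)) · ζ`.

WHAT THIS IS NOT: a door (it hits nothing by itself); the maximal-minor statement above («CLAIM Y»)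
is evidence, not a theorem; nothing on items 20195 / 20172 / 19717 themselves, on crux
stmt-ValiantsHypothesis-14610, or on `VP` versus `VNP`.
-/

set_option linter.dupNamespace false

namespace Summit.ValiantsHypothesis.ValiantsHypothesis.Theorems.BarrierLever.ChowFactor

open Finset MvPolynomial
open Summit.ValiantsHypothesis.ValiantsHypothesis.Theorems.BarrierLever.ProductStateSums (castAdd_ne_natAdd)
open Summit.ValiantsHypothesis.ValiantsHypothesis.Theorems.BarrierLever.CorankRepair (partitionExpo_eq_iff)

noncomputable section

variable {h : ℕ}

/-! ## 1. Monomials in the `x`- or `y`-variables alone -/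

/-- A product of distinct `x`-variables is the monomial `E S ∅`. -/
theorem prod_X_castAdd_eq_monomial {R : Type*} [CommSemiring R] (S : Finset (Fin h)) :
    (∏ k ∈ S, X (Fin.castAdd h k) : MvPolynomial (Fin (h + h)) R) =
      monomial (∑ a ∈ S, Finsupp.single (Fin.castAdd h a) 1 +
        ∑ c ∈ (∅ : Finset (Fin h)), Finsupp.single (Fin.natAdd h c) 1) 1 := by
  classical
  rw [Finset.sum_empty, add_zero]
  induction S using Finset.induction_on with
  | empty => rw [Finset.prod_empty, Finset.sum_empty, monomial_zero', C_1]
  | insert k S hk ih =>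
    rw [Finset.prod_insert hk, Finset.sum_insert hk, ih, X, monomial_mul, one_mul]

/-- A product of distinct `y`-variables is the monomial `E ∅ T`. -/
theorem prod_X_natAdd_eq_monomial {R : Type*} [CommSemiring R] (T : Finset (Fin h)) :
    (∏ c ∈ T, X (Fin.natAdd h c) : MvPolynomial (Fin (h + h)) R) =
      monomial (∑ a ∈ (∅ : Finset (Fin h)), Finsupp.single (Fin.castAdd h a) 1 +
        ∑ c ∈ T, Finsupp.single (Fin.natAdd h c) 1) 1 := by
  classical
  rw [Finset.sum_empty, zero_add]
  induction T using Finset.induction_on with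
  | empty => rw [Finset.prod_empty, Finset.sum_empty, monomial_zero', C_1]
  | insert c T hc ih =>
    rw [Finset.prod_insert hc, Finset.sum_insert hc, ih, X, monomial_mul, one_mul]

/-- **Partition coefficients of an `x`-monomial**: `coeff (E U V) (∏_{k∈S} x_k) = [S = U ∧ V = ∅]`. -/
theorem coeff_partitionExpo_prod_X_castAdd {R : Type*} [CommSemiring R] (S U V : Finset (Fin h)) :
    coeff (∑ a ∈ U, Finsupp.single (Fin.castAdd h a) 1 + ∑ c ∈ V, Finsupp.single (Fin.natAdd h c) 1)
        (∏ k ∈ S, X (Fin.castAdd h k) : MvPolynomial (Fin (h + h)) R) =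
      if S = U ∧ V = ∅ then 1 else 0 := by
  classical
  rw [prod_X_castAdd_eq_monomial, coeff_monomial]
  by_cases hSU : S = U ∧ V = ∅
  · rw [if_pos hSU, if_pos]
    rw [hSU.1, hSU.2]
  · rw [if_neg hSU, if_neg]
    intro heq
    have h2 := (partitionExpo_eq_iff S ∅ U V).mp heq
    exact hSU ⟨h2.1, h2.2.symm⟩

/-- `y`-only polynomials (no `x`-variable among `vars`) have `y`-only support. -/
theorem support_castAdd_eq_zero_of_vars {R : Type*} [CommSemiring R]
    (P : MvPolynomial (Fin (h + h)) R) (hP : ∀ a : Fin h, Fin.castAdd h a ∉ P.vars) :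
    ∀ s ∈ P.support, ∀ a : Fin h, s (Fin.castAdd h a) = 0 := by
  intro s hs a
  by_contra hne
  exact hP a ((mem_vars_iff_mem_support _).mpr ⟨s, hs, Finsupp.mem_support_iff.mpr hne⟩)

/-- Products of `y`-only polynomials are `y`-only. -/
theorem castAdd_notMem_vars_mul {R : Type*} [CommSemiring R] (P Q : MvPolynomial (Fin (h + h)) R)
    (hP : ∀ a : Fin h, Fin.castAdd h a ∉ P.vars) (hQ : ∀ a : Fin h, Fin.castAdd h a ∉ Q.vars) :
    ∀ a : Fin h, Fin.castAdd h a ∉ (P * Q).vars := by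
  classical
  intro a ha
  rcases Finset.mem_union.mp (vars_mul P Q ha) with h1 | h2
  · exact hP a h1
  · exact hQ a h2

/-- Finite products of `y`-only polynomials are `y`-only. -/
theorem castAdd_notMem_vars_prod {R : Type*} [CommSemiring R] {ι : Type*} (s : Finset ι)
    (P : ι → MvPolynomial (Fin (h + h)) R) (hP : ∀ i ∈ s, ∀ a : Fin h, Fin.castAdd h a ∉ (P i).vars) :
    ∀ a : Fin h, Fin.castAdd h a ∉ (∏ i ∈ s, P i).vars := by
  classical
  induction s using Finset.induction_on with
  | empty =>
    intro a
    rw [Finset.prod_empty, vars_one]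
    exact Finset.notMem_empty _
  | insert i s hi ih =>
    rw [Finset.prod_insert hi]
    exact castAdd_notMem_vars_mul _ _ (hP i (Finset.mem_insert_self i s))
      (ih fun i' hi' => hP i' (Finset.mem_insert_of_mem hi'))

/-- **An `x`-monomial times a `y`-only polynomial**: `coeff (E U W) (x^S · P) = [S = U] coeff (E ∅ W) P`. -/
theorem coeff_partitionExpo_prod_X_mul_yOnly {R : Type*} [CommSemiring R] (S U W : Finset (Fin h))
    (P : MvPolynomial (Fin (h + h)) R) (hP : ∀ a : Fin h, Fin.castAdd h a ∉ P.vars) :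
    coeff (∑ a ∈ U, Finsupp.single (Fin.castAdd h a) 1 + ∑ c ∈ W, Finsupp.single (Fin.natAdd h c) 1)
        ((∏ k ∈ S, X (Fin.castAdd h k)) * P) =
      if S = U then coeff (∑ a ∈ (∅ : Finset (Fin h)), Finsupp.single (Fin.castAdd h a) 1 +
        ∑ c ∈ W, Finsupp.single (Fin.natAdd h c) 1) P else 0 := by
  classical
  rw [coeff_partitionExpo_mul_yOnly _ P (support_castAdd_eq_zero_of_vars P hP) U W]
  simp_rw [coeff_partitionExpo_prod_X_castAdd]
  by_cases hSU : S = U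
  · rw [if_pos hSU]
    rw [Finset.sum_eq_single_of_mem W (Finset.mem_powerset.mpr (Finset.Subset.refl W))]
    · rw [if_pos ⟨hSU, Finset.sdiff_self W⟩, one_mul]
    · intro d hd hdW
      have hdsub : d ⊆ W := Finset.mem_powerset.mp hd
      rw [if_neg, zero_mul]
      rintro ⟨-, hWd⟩
      exact hdW (Finset.Subset.antisymm hdsub (Finset.sdiff_eq_empty_iff_subset.mp hWd))
  · rw [if_neg hSU]
    refine Finset.sum_eq_zero fun d _ => ?_
    rw [if_neg (fun hh => hSU hh.1), zero_mul]

/-! ## 2. The normal form of an x-private product -/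

/-- **x-PRIVATE NORMAL FORM.**  For `y`-only `A_k` and `B`,
`coeff (E U W) (B · ∏_k (x_k + A_k)) = coeff (E ∅ W) (B · ∏_{k ∉ U} A_k)`. -/
theorem coeff_partitionExpo_xPrivate {R : Type*} [CommSemiring R]
    (A : Fin h → MvPolynomial (Fin (h + h)) R) (B : MvPolynomial (Fin (h + h)) R)
    (hA : ∀ k, ∀ a : Fin h, Fin.castAdd h a ∉ (A k).vars) (hB : ∀ a : Fin h, Fin.castAdd h a ∉ B.vars)
    (U W : Finset (Fin h)) :
    coeff (∑ a ∈ U, Finsupp.single (Fin.castAdd h a) 1 + ∑ c ∈ W, Finsupp.single (Fin.natAdd h c) 1)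
        (B * ∏ k, (X (Fin.castAdd h k) + A k)) =
      coeff (∑ a ∈ (∅ : Finset (Fin h)), Finsupp.single (Fin.castAdd h a) 1 +
          ∑ c ∈ W, Finsupp.single (Fin.natAdd h c) 1)
        (B * ∏ k ∈ Finset.univ \ U, A k) := by
  classical
  rw [Finset.prod_add, Finset.mul_sum, coeff_sum]
  have hterm : ∀ S ∈ (Finset.univ : Finset (Fin h)).powerset,
      coeff (∑ a ∈ U, Finsupp.single (Fin.castAdd h a) 1 + ∑ c ∈ W, Finsupp.single (Fin.natAdd h c) 1)
        (B * ((∏ k ∈ S, X (Fin.castAdd h k)) * ∏ k ∈ Finset.univ \ S, A k)) =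
      if S = U then coeff (∑ a ∈ (∅ : Finset (Fin h)), Finsupp.single (Fin.castAdd h a) 1 +
          ∑ c ∈ W, Finsupp.single (Fin.natAdd h c) 1) (B * ∏ k ∈ Finset.univ \ U, A k) else 0 := by
    intro S _
    rw [mul_left_comm, coeff_partitionExpo_prod_X_mul_yOnly S U W _
      (castAdd_notMem_vars_mul _ _ hB (castAdd_notMem_vars_prod _ A fun k _ => hA k))]
    by_cases hSU : S = U
    · rw [if_pos hSU, if_pos hSU, hSU]
    · rw [if_neg hSU, if_neg hSU]
  rw [Finset.sum_congr rfl hterm, Finset.sum_ite_eq' ((Finset.univ : Finset (Fin h)).powerset) U,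
    if_pos (Finset.mem_powerset.mpr (Finset.subset_univ U))]

/-- The forms `x_k + A_k` have total degree `≤ 1` when the `A_k` have. -/
theorem totalDegree_X_add_le (k : Fin h) (A : MvPolynomial (Fin (h + h)) ℂ) (hA : A.totalDegree ≤ 1) :
    (X (Fin.castAdd h k) + A).totalDegree ≤ 1 :=
  (totalDegree_add _ _).trans (max_le (by rw [totalDegree_X]) hA)

/-! ## 3. The complementary-products door -/

/-- **COMPLEMENTARY-PRODUCTS DOOR (x-private designs).**  If for some `y`-only forms `A_k` and
`B_j` of total degree `≤ 1` the `y`-coefficient determinant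
`det[coeff (E ∅ (w j)) ((∏ B) · ∏_{k ∉ u i} A_k)]` is nonzero, the layout `(u, w)` is Chow-hit
by the `h + h` affine forms `x_k + A_k`, `B_j`. -/
theorem chow_hit_of_complementaryProducts {r : ℕ} (u w : Fin r → Finset (Fin h))
    (A B : Fin h → MvPolynomial (Fin (h + h)) ℂ)
    (hA1 : ∀ k, (A k).totalDegree ≤ 1) (hB1 : ∀ j, (B j).totalDegree ≤ 1)
    (hAy : ∀ k, ∀ a : Fin h, Fin.castAdd h a ∉ (A k).vars)
    (hBy : ∀ j, ∀ a : Fin h, Fin.castAdd h a ∉ (B j).vars)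
    (hdet : (Matrix.of fun i j : Fin r => coeff
        (∑ a ∈ (∅ : Finset (Fin h)), Finsupp.single (Fin.castAdd h a) 1 +
          ∑ c ∈ w j, Finsupp.single (Fin.natAdd h c) 1)
        ((∏ j', B j') * ∏ k ∈ Finset.univ \ u i, A k)).det ≠ 0) :
    ∃ ℓ : Fin (h + h) → MvPolynomial (Fin (h + h)) ℂ, (∀ q, (ℓ q).totalDegree ≤ 1) ∧
      (Matrix.of fun i j : Fin r => coeff
        (∑ a ∈ u i, Finsupp.single (Fin.castAdd h a) 1 + ∑ c ∈ w j, Finsupp.single (Fin.natAdd h c) 1)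
        (∏ q, ℓ q)).det ≠ 0 := by
  classical
  refine ⟨Fin.append (fun k => X (Fin.castAdd h k) + A k) B, fun q => ?_, ?_⟩
  · induction q using Fin.addCases with
    | left k =>
      rw [Fin.append_left]
      exact totalDegree_X_add_le k (A k) (hA1 k)
    | right j =>
      rw [Fin.append_right]
      exact hB1 j
  · have hprod : (∏ q, Fin.append (fun k => X (Fin.castAdd h k) + A k) B q) =
        (∏ j, B j) * ∏ k, (X (Fin.castAdd h k) + A k) := by
      rw [Fin.prod_univ_add]
      simp only [Fin.append_left, Fin.append_right]
      rw [mul_comm]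
    have hM : (Matrix.of fun i j : Fin r => coeff
        (∑ a ∈ u i, Finsupp.single (Fin.castAdd h a) 1 + ∑ c ∈ w j, Finsupp.single (Fin.natAdd h c) 1)
        (∏ q, Fin.append (fun k => X (Fin.castAdd h k) + A k) B q)) =
        Matrix.of fun i j : Fin r => coeff
          (∑ a ∈ (∅ : Finset (Fin h)), Finsupp.single (Fin.castAdd h a) 1 +
            ∑ c ∈ w j, Finsupp.single (Fin.natAdd h c) 1)
          ((∏ j', B j') * ∏ k ∈ Finset.univ \ u i, A k) := by
      ext i j
      rw [Matrix.of_apply, Matrix.of_apply, hprod,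
        coeff_partitionExpo_xPrivate A _ hAy (castAdd_notMem_vars_prod _ B fun j _ => hBy j)]
    rw [hM]
    exact hdet

/-! ## 4. The cube-evaluation form: `B_j = 1 + y_j` -/

/-- The coefficients of `∏_c (1 + y_c)` on the `y`-monomials are all `1`. -/
theorem coeff_partitionExpo_cubeFactor {R : Type*} [CommSemiring R] (V : Finset (Fin h)) :
    coeff (∑ a ∈ (∅ : Finset (Fin h)), Finsupp.single (Fin.castAdd h a) 1 +
        ∑ c ∈ V, Finsupp.single (Fin.natAdd h c) 1)
      (∏ c : Fin h, (1 + X (Fin.natAdd h c)) : MvPolynomial (Fin (h + h)) R) = 1 := by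
  classical
  rw [Finset.prod_add, coeff_sum]
  simp_rw [Finset.prod_const_one, one_mul, prod_X_natAdd_eq_monomial, coeff_monomial]
  rw [Finset.sum_ite, Finset.sum_const_zero, add_zero, Finset.sum_const, Nat.smul_one_eq_cast]
  have hfilter : ((Finset.univ : Finset (Fin h)).powerset.filter fun T =>
      (∑ a ∈ (∅ : Finset (Fin h)), Finsupp.single (Fin.castAdd h a) 1 +
          ∑ c ∈ Finset.univ \ T, Finsupp.single (Fin.natAdd h c) 1 : Fin (h + h) →₀ ℕ) =
        ∑ a ∈ (∅ : Finset (Fin h)), Finsupp.single (Fin.castAdd h a) 1 +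
          ∑ c ∈ V, Finsupp.single (Fin.natAdd h c) 1) = {Finset.univ \ V} := by
    ext T
    rw [Finset.mem_filter, Finset.mem_singleton, partitionExpo_eq_iff]
    constructor
    · rintro ⟨-, -, hT⟩
      rw [← hT, Finset.sdiff_sdiff_eq_self (Finset.subset_univ T)]
    · intro hT
      refine ⟨Finset.mem_powerset.mpr (Finset.subset_univ T), rfl, ?_⟩
      rw [hT, Finset.sdiff_sdiff_eq_self (Finset.subset_univ V)]
  rw [hfilter, Finset.card_singleton, Nat.cast_one]

/-- **Cube evaluation.**  For `y`-only `P`: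
`coeff (E ∅ W) ((∏_c (1 + y_c)) · P) = Σ_{Z ⊆ W} coeff (E ∅ Z) P` — the value of the multilinear
truncation of `P` at the `0/1` point `1_W`. -/
theorem coeff_partitionExpo_cubeFactor_mul {R : Type*} [CommSemiring R] (W : Finset (Fin h))
    (P : MvPolynomial (Fin (h + h)) R) (hP : ∀ a : Fin h, Fin.castAdd h a ∉ P.vars) :
    coeff (∑ a ∈ (∅ : Finset (Fin h)), Finsupp.single (Fin.castAdd h a) 1 +
        ∑ c ∈ W, Finsupp.single (Fin.natAdd h c) 1)
      ((∏ c : Fin h, (1 + X (Fin.natAdd h c))) * P) =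
      ∑ Z ∈ W.powerset, coeff (∑ a ∈ (∅ : Finset (Fin h)), Finsupp.single (Fin.castAdd h a) 1 +
        ∑ c ∈ Z, Finsupp.single (Fin.natAdd h c) 1) P := by
  classical
  rw [coeff_partitionExpo_mul_yOnly _ P (support_castAdd_eq_zero_of_vars P hP) ∅ W]
  refine Finset.sum_congr rfl fun Z _ => ?_
  rw [coeff_partitionExpo_cubeFactor, one_mul]

/-- The forms `1 + y_c` are `y`-only of total degree `≤ 1`. -/
theorem totalDegree_one_add_X_natAdd_le (c : Fin h) :
    ((1 + X (Fin.natAdd h c)) : MvPolynomial (Fin (h + h)) ℂ).totalDegree ≤ 1 :=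
  (totalDegree_add _ _).trans (max_le (by rw [totalDegree_one]; exact Nat.zero_le _)
    (by rw [totalDegree_X]))

/-- The forms `1 + y_c` involve no `x`-variable. -/
theorem castAdd_notMem_vars_one_add_X_natAdd (c : Fin h) :
    ∀ a : Fin h, Fin.castAdd h a ∉ ((1 + X (Fin.natAdd h c)) : MvPolynomial (Fin (h + h)) ℂ).vars := by
  classical
  intro a ha
  have hsub := vars_add_subset (1 : MvPolynomial (Fin (h + h)) ℂ) (X (Fin.natAdd h c)) ha
  rw [vars_one, Finset.empty_union, vars_X, Finset.mem_singleton] at hsub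
  exact castAdd_ne_natAdd a c hsub

/-- **CUBE-EVALUATION DOOR.**  If for some `y`-only forms `A_k` of total degree `≤ 1` the matrix of
cube evaluations `Σ_{Z ⊆ w j} coeff (E ∅ Z) (∏_{k ∉ u i} A_k)` of the complementary products is
nonsingular, the layout `(u, w)` is Chow-hit (by the forms `x_k + A_k` and `1 + y_c`). -/
theorem chow_hit_of_cubeEvaluations {r : ℕ} (u w : Fin r → Finset (Fin h))
    (A : Fin h → MvPolynomial (Fin (h + h)) ℂ)
    (hA1 : ∀ k, (A k).totalDegree ≤ 1) (hAy : ∀ k, ∀ a : Fin h, Fin.castAdd h a ∉ (A k).vars)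
    (hdet : (Matrix.of fun i j : Fin r => ∑ Z ∈ (w j).powerset, coeff
        (∑ a ∈ (∅ : Finset (Fin h)), Finsupp.single (Fin.castAdd h a) 1 +
          ∑ c ∈ Z, Finsupp.single (Fin.natAdd h c) 1)
        (∏ k ∈ Finset.univ \ u i, A k)).det ≠ 0) :
    ∃ ℓ : Fin (h + h) → MvPolynomial (Fin (h + h)) ℂ, (∀ q, (ℓ q).totalDegree ≤ 1) ∧
      (Matrix.of fun i j : Fin r => coeff
        (∑ a ∈ u i, Finsupp.single (Fin.castAdd h a) 1 + ∑ c ∈ w j, Finsupp.single (Fin.natAdd h c) 1)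
        (∏ q, ℓ q)).det ≠ 0 := by
  classical
  refine chow_hit_of_complementaryProducts u w A (fun c => 1 + X (Fin.natAdd h c)) hA1
    totalDegree_one_add_X_natAdd_le hAy castAdd_notMem_vars_one_add_X_natAdd ?_
  have hM : (Matrix.of fun i j : Fin r => coeff
        (∑ a ∈ (∅ : Finset (Fin h)), Finsupp.single (Fin.castAdd h a) 1 +
          ∑ c ∈ w j, Finsupp.single (Fin.natAdd h c) 1)
        ((∏ j' : Fin h, (1 + X (Fin.natAdd h j'))) * ∏ k ∈ Finset.univ \ u i, A k)) =
      Matrix.of fun i j : Fin r => ∑ Z ∈ (w j).powerset, coeff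
        (∑ a ∈ (∅ : Finset (Fin h)), Finsupp.single (Fin.castAdd h a) 1 +
          ∑ c ∈ Z, Finsupp.single (Fin.natAdd h c) 1)
        (∏ k ∈ Finset.univ \ u i, A k) := by
    ext i j
    rw [Matrix.of_apply, Matrix.of_apply, coeff_partitionExpo_cubeFactor_mul _ _
      (castAdd_notMem_vars_prod _ A fun k _ => hAy k)]
  rw [hM]
  exact hdet

end

end Summit.ValiantsHypothesis.ValiantsHypothesis.Theorems.BarrierLever.ChowFactor
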